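import Mathlib
import HarnessLib
import Literature.NumberTheory.Irrationality.Zudilin2014.FirstTaleArithmetic
import Literature.NumberTheory.Irrationality.Zudilin2014.SecondTale
import Literature.NumberTheory.Transcendental.PeriodsWave0
import Summits.KontsevichZagierPeriods.Zeta5Search.Denom.TwoTaleP15Forms
import Summits.KontsevichZagierPeriods.Zeta5Search.Denom.TwoTaleD1Saving

/-!
# Rung D1 = L(1/3) — the point `(19,16,13,22 | 0,3,6,38)`, its forms, its Remark-5 partner, and the CONDITIONAL measure

HONEST FRAMING: systematic search; no irrationality claim unless certified.  This file claims NO measure of `ζ(2)`.  It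
is input F2 of the D1 programme (`families/denom/D1-DESIGN-NOTE.md`, lead rulings R-D1′; design value `μ(ζ(2)) ≤ 5.0205`,
a DESIGN VALUE until the capstone `TwoTaleD1Measure` is certified): it instantiates the tree's general first-tale objects of
Zudilin 2014 (`Zudilin2014.formQZ`, `Zudilin2014.formP`; arXiv:1310.1526 = [Zudilin2014ZetaTwo], Prop. 1, §3) at the
ladder point `a = (19n+1, 16n+1, 13n+1, 22n+1)`, `b = (1, 3n+1, 6n+1, 38n+2)` (`a₄* = 22n+1`, `a₂* = 16n+1`,
`d = 23n−1`, normaliser `D₂₂ₙ D₂₃ₙ`), names its Remark-5 partner `â = (47n+2; 16n+1, 19n+1, 22n+1)`,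
`b̂ = (22n+2; 9n+1, 35n+2, 38n+2)`, and PROVES the implication from four named inputs to the measure:
* `InclusionD1` — `Φₙ ∣ D₂₂ₙD₂₃ₙ qₙ` and `Φₙ⁻¹ D₂₂ₙD₂₃ₙ pₙ ∈ ℤ` for the explicit joint saving `Φₙ = savingProductD1 n` of
  `TwoTaleD1Saving` (to be DISCHARGED by `TwoTaleD1Inclusion`: Lemma 7 cells + Lemma 8 cells through the two-tale
  identity (bmiss) `q = −q̂, p = −p̂`, itself the tree's `TwoTaleOmega.bmiss_on_Omega` at the ladder point);
* `DecayD1 c` — `|qₙζ(2) − pₙ| ≤ e^{−cn}` eventually (design `C₀ = 42.33438300`; P1's `TwoTaleD1Decay` proves `c = 42.33437`);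
* `CoeffRateD1 C₁` — `(1/n) log|qₙ| → C₁` (design `C₁ = 60.80787975`; P1's `TwoTaleD1GrowthLimit`/`…Enclosure`:
  `CoeffRateD1 C₁starD1`, `0 < C₁starD1 ≤ 60.8079`);
* `DecayTD1 c` — the partner's decay (used only by the (bmiss)-free W1 derivation of the coincidence; not by this file).
PROVED here: the point data (`admissibleD1`, `amaxD1_eq`, `a2starD1_eq`, `dExpD1_eq`, `formQD1_cast`) — this head is
P1 g12's interface draft, adopted verbatim so that the analytic T-files compile unchanged — and
* **`exponentLE_of_inputsD1`**: `InclusionD1 → DecayD1 c → CoeffRateD1 C₁ → 45 − S < c → 0 < C₁ →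
  ExponentLE (ζ(2)) (1 + (C₁ + (45 − S))/(c − (45 − S)))`, `S = savingRateD1 = ∫ν dψ ∈ [23.20999, 23.21011]` (certified in
  `TwoTaleD1Saving`), via the tree's abstract `TwoTaleP15Forms.exponentLE_of_normalisedForms` and `irrational_zetaValue_two`;
* **`zetaTwo_exponent_le_D1_of_inputs`**: `InclusionD1 → DecayD1 42.33437 → CoeffRateD1 C₁ → 0 < C₁ → C₁ ≤ 60.808 →
  ExponentLE (ζ(2)) 5.0205` (kernel arithmetic: `1 + (60.808 + 45 − 23.20999)/(42.33437 − 45 + 23.20999) = 5.02047… ≤ 5.0205`;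
  the claim form `5.0205` therefore STANDS — no fallback needed — once the three inputs are theorems).
AN IMPLICATION ONLY.  The (bmiss)-free derivation (W1 leg) and the capstone are separate files.
-/

noncomputable section

open Filter Topology Finset
open Literature.NumberTheory.Transcendental
open Literature.NumberTheory.Irrationality
open Literature.NumberTheory.Irrationality.Zudilin2014
open Summit.KontsevichZagierPeriods.Zeta5Search.Denom.TwoTaleD1Saving

namespace Summit.KontsevichZagierPeriods.Zeta5Search.Denom.TwoTaleD1Forms

/-- The slopes `(19, 16, 13, 22)` of `a_j = α_j n + 1`. -/
def slopeD1 : Fin 4 → ℕ := ![19, 16, 13, 22]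

/-- `a = (19n+1, 16n+1, 13n+1, 22n+1)`. -/
def aD1 (n : ℕ) : Fin 4 → ℤ := fun i => (slopeD1 i : ℤ) * n + 1

/-- `b = (1, 3n+1, 6n+1, 38n+2)`. -/
def bD1 (n : ℕ) : Fin 4 → ℤ := ![1, 3 * (n : ℤ) + 1, 6 * (n : ℤ) + 1, 38 * (n : ℤ) + 2]

/-- `aD1_zero` (simp lemma). -/
@[simp] theorem aD1_zero (n : ℕ) : aD1 n 0 = 19 * n + 1 := by simp [aD1, slopeD1]
/-- `aD1_one` (simp lemma). -/
@[simp] theorem aD1_one (n : ℕ) : aD1 n 1 = 16 * n + 1 := by simp [aD1, slopeD1]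
/-- `aD1_two` (simp lemma). -/
@[simp] theorem aD1_two (n : ℕ) : aD1 n 2 = 13 * n + 1 := by simp [aD1, slopeD1]
/-- `aD1_three` (simp lemma). -/
@[simp] theorem aD1_three (n : ℕ) : aD1 n 3 = 22 * n + 1 := by simp [aD1, slopeD1]
/-- `bD1_zero` (simp lemma). -/
@[simp] theorem bD1_zero (n : ℕ) : bD1 n 0 = 1 := rfl
/-- `bD1_one` (simp lemma). -/
@[simp] theorem bD1_one (n : ℕ) : bD1 n 1 = 3 * (n : ℤ) + 1 := rfl
/-- `bD1_two` (simp lemma). -/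
@[simp] theorem bD1_two (n : ℕ) : bD1 n 2 = 6 * (n : ℤ) + 1 := rfl
/-- `bD1_three` (simp lemma). -/
@[simp] theorem bD1_three (n : ℕ) : bD1 n 3 = 38 * (n : ℤ) + 2 := rfl

/-- The point is admissible for `n ≥ 1` (eq. (cond1): `b_j ≤ a_i < b₄`; `d = 23n − 1 ≥ 0`). -/
theorem admissibleD1 {n : ℕ} (hn : 1 ≤ n) : Zudilin2014.Admissible (aD1 n) (bD1 n) where
  lower j hj i := by
    have hi : (13 : ℤ) * n + 1 ≤ aD1 n i := by fin_cases i <;> simp <;> omega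
    fin_cases j <;> simp at hj ⊢ <;> linarith
  upper i := by
    have hi : aD1 n i ≤ 22 * (n : ℤ) + 1 := by fin_cases i <;> simp <;> omega
    simp only [bD1_three]; linarith
  balance := by
    simp only [Fin.sum_univ_four, bD1_zero, bD1_one, bD1_two, bD1_three, aD1_zero, aD1_one, aD1_two, aD1_three]
    omega

/-- `a₄* = 22n + 1`. -/
theorem amaxD1_eq (n : ℕ) : amax (aD1 n) = 22 * (n : ℤ) + 1 := by
  unfold amax; simp only [aD1_zero, aD1_one, aD1_two, aD1_three]; omega

/-- `a₂* = 16n + 1`. -/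
theorem a2starD1_eq (n : ℕ) : a2star (aD1 n) = 16 * (n : ℤ) + 1 := by
  apply le_antisymm
  · unfold a2star
    refine sup'_le _ _ fun i _ => ?_
    by_cases hi : i = 1
    · subst hi
      calc minOthers (aD1 n) 1 ≤ aD1 n 2 := minOthers_le (aD1 n) (by decide)
        _ ≤ 16 * (n : ℤ) + 1 := by rw [aD1_two]; omega
    · calc minOthers (aD1 n) i ≤ aD1 n 1 := minOthers_le (aD1 n) (fun h => hi h.symm)
        _ = 16 * (n : ℤ) + 1 := aD1_one n
  · have h : 16 * (n : ℤ) + 1 ≤ minOthers (aD1 n) 2 := by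
      unfold minOthers
      refine le_inf' _ _ fun j hj => ?_
      have hj' : j ≠ 2 := (mem_erase.1 hj).1
      fin_cases j <;> simp at hj' ⊢ <;> omega
    exact h.trans (le_sup' (minOthers (aD1 n)) (mem_univ 2))

/-- `d = 23n − 1`. -/
theorem dExpD1_eq (n : ℕ) : dExp (aD1 n) (bD1 n) = 23 * n - 1 := by
  unfold dExp
  simp only [Fin.sum_univ_four, bD1_zero, bD1_one, bD1_two, bD1_three, aD1_zero, aD1_one, aD1_two, aD1_three]
  omega

/-! ### The forms and the tale-1 inputs -/

/-- **`qₙ ∈ ℤ`** at D1: `Zudilin2014.formQZ (aD1 n) (bD1 n)`. -/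
def formQD1 (n : ℕ) : ℤ := Zudilin2014.formQZ (aD1 n) (bD1 n)

/-- **`pₙ ∈ ℚ`** at D1: `Zudilin2014.formP (aD1 n) (bD1 n)`. -/
def formPD1 (n : ℕ) : ℚ := Zudilin2014.formP (aD1 n) (bD1 n)

/-- `qₙ` is the rational form `q(a,b)` of Prop. 1 (`FirstTaleArithmetic.formQ_eq_cast`). -/
theorem formQD1_cast {n : ℕ} (hn : 1 ≤ n) : (formQD1 n : ℚ) = Zudilin2014.formQ (aD1 n) (bD1 n) :=
  (Zudilin2014.formQ_eq_cast (admissibleD1 hn)).symm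

/-- **INPUT — decay** with constant `c`: `|qₙ ζ(2) − pₙ| ≤ e^{−cn}` eventually (design `C₀ = 42.33438300`). -/
@[conjecture] def DecayD1 (c : ℝ) : Prop :=
  ∀ᶠ n : ℕ in atTop, |(formQD1 n : ℝ) * zetaValue 2 - (formPD1 n : ℝ)| ≤ Real.exp (-(c * n))

/-- **INPUT — coefficient rate** `C₁`: `(1/n) log|qₙ| → C₁` (design `C₁ = 60.80787975`). -/
@[conjecture] def CoeffRateD1 (C₁ : ℝ) : Prop :=
  Tendsto (fun n : ℕ => Real.log |(formQD1 n : ℝ)| / n) atTop (𝓝 C₁)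

/-! ### The Remark-5 partner (second tale) -/

/-- The D1 partner `â = (47n+2; 16n+1, 19n+1, 22n+1)` ([Zudilin2014ZetaTwo] Remark 5 at `(19,16,13,22 | 0,3,6,38)`). -/
def aTD1 (n : ℕ) : Fin 4 → ℤ := ![47 * (n : ℤ) + 2, 16 * (n : ℤ) + 1, 19 * (n : ℤ) + 1, 22 * (n : ℤ) + 1]

/-- The D1 partner `b̂ = (22n+2; 9n+1, 35n+2, 38n+2)`. -/
def bTD1 (n : ℕ) : Fin 4 → ℤ := ![22 * (n : ℤ) + 2, 9 * (n : ℤ) + 1, 35 * (n : ℤ) + 2, 38 * (n : ℤ) + 2]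

/-- Component `aTD1 0 = 47n+2`. -/
@[simp] theorem aTD1_zero (n : ℕ) : aTD1 n 0 = 47 * (n : ℤ) + 2 := rfl
/-- Component `aTD1 1 = 16n+1`. -/
@[simp] theorem aTD1_one (n : ℕ) : aTD1 n 1 = 16 * (n : ℤ) + 1 := rfl
/-- Component `aTD1 2 = 19n+1`. -/
@[simp] theorem aTD1_two (n : ℕ) : aTD1 n 2 = 19 * (n : ℤ) + 1 := rfl
/-- Component `aTD1 3 = 22n+1`. -/
@[simp] theorem aTD1_three (n : ℕ) : aTD1 n 3 = 22 * (n : ℤ) + 1 := rfl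
/-- Component `bTD1 0 = 22n+2`. -/
@[simp] theorem bTD1_zero (n : ℕ) : bTD1 n 0 = 22 * (n : ℤ) + 2 := rfl
/-- Component `bTD1 1 = 9n+1`. -/
@[simp] theorem bTD1_one (n : ℕ) : bTD1 n 1 = 9 * (n : ℤ) + 1 := rfl
/-- Component `bTD1 2 = 35n+2`. -/
@[simp] theorem bTD1_two (n : ℕ) : bTD1 n 2 = 35 * (n : ℤ) + 2 := rfl
/-- Component `bTD1 3 = 38n+2`. -/
@[simp] theorem bTD1_three (n : ℕ) : bTD1 n 3 = 38 * (n : ℤ) + 2 := rfl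

/-- **INPUT — second-tale decay** with constant `c`: `|q̂ₙ ζ(2) − p̂ₙ| ≤ e^{−cn}` eventually at the partner
(`formQT`/`formPT` at `aTD1 n`, `bTD1 n`; design `C₀ᵀ = 42.33438300`, W1 floor `40.6`). -/
@[conjecture] def DecayTD1 (c : ℝ) : Prop :=
  ∀ᶠ n : ℕ in atTop,
    |(formQT (aTD1 n) (bTD1 n) : ℝ) * zetaValue 2 - (formPT (aTD1 n) (bTD1 n) : ℝ)| ≤ Real.exp (-(c * n))


/-! ### The normaliser and the inclusion input -/

/-- The normaliser `D₂₂ₙ · D₂₃ₙ` (Prop. 1 at the point: `M₁ = a₄* − 1 = 22n`, `M₂ = max(d, b₄ − a₂* − 1) = 23n − 1 ≤ 23n`). -/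
def lcmNormaliserD1 (n : ℕ) : ℕ := Nat.lcmUpto (22 * n) * Nat.lcmUpto (23 * n)

/-- `D₂₂ₙ D₂₃ₙ > 0`. -/
theorem lcmNormaliserD1_pos (n : ℕ) : 0 < lcmNormaliserD1 n :=
  Nat.mul_pos (Nat.lcmUpto_pos _) (Nat.lcmUpto_pos _)

/-- **INPUT — inclusion** (Lemma 7 ∪ Lemma 8 ∪ (bmiss) at the point): `Φₙ ∣ D₂₂ₙD₂₃ₙ qₙ` and `Φₙ⁻¹ D₂₂ₙD₂₃ₙ pₙ ∈ ℤ`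
for `n ≥ 1`, `Φₙ = savingProductD1 n` (primes `48√n < p ≤ 22n`, digit `ν = max(φ, φ̂)`).  Discharged by the successor
`TwoTaleD1Inclusion`; an input here. -/
@[conjecture] def InclusionD1 : Prop :=
  ∀ n : ℕ, 1 ≤ n →
    (∃ B : ℤ, ((lcmNormaliserD1 n : ℕ) : ℤ) * formQD1 n = (savingProductD1 n : ℤ) * B) ∧
      ∃ A : ℤ, ((lcmNormaliserD1 n : ℕ) : ℚ) * formPD1 n = (savingProductD1 n : ℚ) * A

/-! ### The conditional measure (PROVED implication) -/

/-- The normaliser rate: `(1/n) log (D₂₂ₙD₂₃ₙ/Φₙ) → 45 − S` (`TwoTaleD1Saving.tendsto_log_lcmNormaliserD1_div`). -/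
theorem tendsto_log_lcmNormaliserD1_div_savingProductD1 :
    Tendsto (fun n : ℕ => Real.log ((lcmNormaliserD1 n : ℝ) / savingProductD1 n) / n) atTop
      (𝓝 (45 - savingRateD1)) := by
  refine tendsto_log_lcmNormaliserD1_div.congr fun n => ?_
  simp only [lcmNormaliserD1, Nat.cast_mul]

/-- **The measure at rung D1 from the three inputs (PROVED implication)**, `S = savingRateD1`:
`μ(ζ(2)) ≤ 1 + (C₁ + (45 − S))/(c − (45 − S))` in the `ExponentLE` sense. -/
theorem exponentLE_of_inputsD1 {c C₁ : ℝ} (hI : InclusionD1) (hD : DecayD1 c) (hC : CoeffRateD1 C₁)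
    (hc : 45 - savingRateD1 < c) (hC₀ : 0 < C₁) :
    ExponentLE (zetaValue 2) (1 + (C₁ + (45 - savingRateD1)) / (c - (45 - savingRateD1))) := by
  choose! B hB using fun n (hn : 1 ≤ n) => (hI n hn).1
  choose! A hA using fun n (hn : 1 ≤ n) => (hI n hn).2
  have hS := savingRateD1_lt
  exact Denom.TwoTaleP15Forms.exponentLE_of_normalisedForms Denom.TwoTaleP15Forms.irrational_zetaValue_two
    lcmNormaliserD1_pos savingProductD1_pos hB hA hD hC tendsto_log_lcmNormaliserD1_div_savingProductD1 hc hC₀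
    (by linarith)

/-- **Rung D1, numerically (PROVED implication; the inputs are the successors' theorems, not this file's):**
`c = 42.33437` (`< C₀ = 42.33438300`), `0 < C₁ ≤ 60.808` and the certified `S ≥ 23.20999` give **`μ(ζ(2)) ≤ 5.0205`**
(design value `5.02045247…`; kernel bound `5.020472`). -/
theorem zetaTwo_exponent_le_D1_of_inputs {C₁ : ℝ} (hI : InclusionD1) (hD : DecayD1 42.33437)
    (hC : CoeffRateD1 C₁) (hC₀ : 0 < C₁) (hC₁ : C₁ ≤ 60.808) : ExponentLE (zetaValue 2) 5.0205 := by
  have hS := savingRateD1_bounds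
  have h := exponentLE_of_inputsD1 hI hD hC (by linarith [hS.1]) hC₀
  have hden : 0 < 42.33437 - (45 - savingRateD1) := by linarith [hS.1]
  have hle : 1 + (C₁ + (45 - savingRateD1)) / (42.33437 - (45 - savingRateD1)) ≤ 5.0205 := by
    have h1 : (C₁ + (45 - savingRateD1)) / (42.33437 - (45 - savingRateD1)) ≤ 4.0205 := by
      rw [div_le_iff₀ hden]
      linarith [hS.1]
    linarith
  exact h.mono hle

/-- **Loose-constant variant** (margins for the inputs): `c = 42.3`, `0 < C₁ ≤ 60.9` give `μ(ζ(2)) ≤ 5.034`. -/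
theorem zetaTwo_exponent_le_D1_loose {C₁ : ℝ} (hI : InclusionD1) (hD : DecayD1 42.3) (hC : CoeffRateD1 C₁)
    (hC₀ : 0 < C₁) (hC₁ : C₁ ≤ 60.9) : ExponentLE (zetaValue 2) 5.034 := by
  have hS := savingRateD1_bounds
  have h := exponentLE_of_inputsD1 hI hD hC (by linarith [hS.1]) hC₀
  have hden : 0 < 42.3 - (45 - savingRateD1) := by linarith [hS.1]
  have hle : 1 + (C₁ + (45 - savingRateD1)) / (42.3 - (45 - savingRateD1)) ≤ 5.034 := by
    have h1 : (C₁ + (45 - savingRateD1)) / (42.3 - (45 - savingRateD1)) ≤ 4.034 := by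
      rw [div_le_iff₀ hden]
      linarith [hS.1]
    linarith
  exact h.mono hle

end Summit.KontsevichZagierPeriods.Zeta5Search.Denom.TwoTaleD1Forms

end
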